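import Literature.MathematicalPhysics.QuantumFieldTheory.Balaban1983to89.Node00.Record12DatumKey

/-!
# NODE 00 (YM-PLAN Track A) — THE DATUM ∕ RECORD KEYS AT STAGE 12 RESTRICTED TO A REGIME OF PARAMETERS (`IsDatumOfRecord₁₂COn`, `IsRecordOfRecord₁₂COn`),
# THEIR CANONICAL PARAMETER IN THE REGIME, CANONICALISED READINGS RELATIVE TO THE REGIME (`canon₁₂On`), AND THE INSTANCES AT THE GUARD OF RECORD
# «print's partition of unity ∧ non-degenerate present slots» (`unityNondeg₁₂`; `IsDatumOfRecord₁₂CN`, `IsRecordOfRecord₁₂CN` — the «CN key»)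

NODE 00 RECORD MODULE (cell `pub-ymgap`, seat `pub-ymgap-node00-def-RR-2` gen 3 = key ∕ second-reader side of the RATE-RECORD HOME, director-ym R141 (A); dag-lead
WORDS-110 (2) ∕ WORDS-111, NODE-TABLE v28).  v1.1 LEAF of this seat's `Node00/Record12DatumKey` (gen 2: the C key `IsDatumOfRecord₁₂C`, its canonical parameter
`.params`, `canon₁₂`, `IsRateKey₁₂`): a NEW module importing that key ONLY; nothing landed is edited or re-keyed; everything it reads is CONSUMED BY NAME.

WHY THIS OBJECT.  The route's Stage-12 items (rev 15) guard the parameter tuple by ONE bundled conjunction on the SAME `θ` as the datum — K0′ `Record12Inhabited` reads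
«`∀ F, ∃ θ : Stage12Params F 2, θ.Provisos₁₂ F 2 ∧ (θ.ZtUnity F 2 ∧ θ.SlotsNondegenerate) ∧ θ.Admissible F 2`», K2′ ∕ K3′ read «`∀ F θ (h : θ.Provisos₁₂ F 2),
(θ.ZtUnity F 2 ∧ θ.SlotsNondegenerate) → θ.Admissible F 2 → …`» (director-ym LINE №112: consumers take the guard as ONE binder and destructure).  The C key carries
`Provisos₁₂ ∧ Admissible` ONLY, and a guard on `θ` does NOT reach the C-canonical parameter `IsDatumOfRecord₁₂C.params = Classical.choose _` of `θ`'s datum (dag-ref-H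
XXVII-PRE-READ-NOTE: two tuples with one datum are not excluded; no `params = θ` lemma exists or can).  So the landed C-keyed homes STAY (a reading quantified over the weaker
key is the stronger statement — dag-lead WORDS-110 (1)), and a reading that genuinely CONSUMES unity ∕ non-degeneracy needs a key of its own to quantify over: at the tuple
level the (T-RATE) ∕ (T-SPINE) pens supply the regime-restricted homes `YMDAG.UVSplit.RRec₁₂On 𝔯 Rg` ∕ `SRec₁₂On cr Rg` (regime `Rg : (F : T4Family) → Stage12Params F N →
Prop`, bundles read AT the tuple); this module supplies, ONCE for every regime `Rg`, the matching DATUM key `IsDatumOfRecord₁₂COn F N Rg D` (= the common prefix «`∃ θ hP,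
Rg F θ ∧ θ.Admissible F N ∧ D = datumOfRecord₁₂ F N θ hP`» of those homes' keys), the RECORD key `IsRecordOfRecord₁₂COn F N Rg D w` (`IsRecordOfRecord₁₂C`'s body with the
regime conjunct), the CANONICAL PARAMETER IN THE REGIME `h.params` (choice; `h.regime : Rg F h.params` — the regime DOES reach it), the `forall_params` face, the world
companions, the junction «a world-blind property at every regime record ⟺ the θ-keyed sentence guarded by `Rg`» (`forall_isRecordOfRecord₁₂COn_iff`, the shape a guarded
K3′ composer reads the item's text off), and the canonicalised readings `canon₁₂On Rg` with the keyed-record face and COHERENCE (`exists_keyed_canon₁₂On_iff`,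
`keyed_canon₁₂On_coherent`: two regime homes read through `canon₁₂On Rg` admit, at one datum, readings AT ONE PARAMETER — the N19′ edge reads the spine and rate bundles
jointly).  §4 names THE GUARD OF RECORD `unityNondeg₁₂ N F θ := θ.ZtUnity F N ∧ θ.SlotsNondegenerate` and instantiates: `IsDatumOfRecord₁₂CN` ∕ `IsRecordOfRecord₁₂CN`
(the «CN key»: C + uNity + Non-degenerate), with the literal faces `isDatumOfRecord₁₂CN_iff`, `exists_isDatumOfRecord₁₂CN_iff_exists_params` (= K0′'s rev-15 body at
`(F, N)` VERBATIM) and `forall_isRecordOfRecord₁₂CN_iff` (= the K2′ ∕ K3′ binder prefix).  At the trivial regime everything is the C key again (`isDatumOfRecord₁₂COn_true_iff`,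
`isRecordOfRecord₁₂COn_true_iff`).

HONEST FRAMING.  Definitions of record + kernel bookkeeping (`Classical.choose`, `rfl`, ∃-repackaging); NO inhabitant of any key is claimed (K0′ open); nothing of Bałaban's
is asserted; no node is discharged; counts unmoved; one finite four-torus programme at fixed `ε` — NOT the continuum limit on ℝ⁴, NOT infinite volume, NOT OS, NOT a mass gap,
NOT the Clay problem.  No `sorry` ∕ `axiom` ∕ `opaque` ∕ `instance` ∕ `notation`.  [Balaban1989LargeFieldII] = Commun. Math. Phys. **122** (1989) 355–392;
[Balaban1988Convergent] = Commun. Math. Phys. **119** (1988) 243–285; [Balaban1987RG1] = Commun. Math. Phys. **109** (1987) 249–301.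
-/

noncomputable section

namespace Literature.MathematicalPhysics.QuantumFieldTheory.Balaban1983to89.Node00

open T4Continuum AveragingRT T4FiniteEpsInhabited FlowStep FlowStepRuns DagBinding T4DatumAssembly

/-! ## §1. «`D` is a datum of record, Stage 12, realised IN THE REGIME `Rg`» and its canonical parameter in the regime -/

section DatumKeyOn

variable (F : T4Family) (N : ℕ) [NeZero N]

/-- **«`D` is a datum of record, Stage 12, realised in the regime `Rg`»**: SOME admissible Stage-12 parameter IN `Rg` satisfying its displayed provisos has `D` as its datum
of record — the common key prefix of the regime-restricted carrier homes (`RRec₁₂On 𝔯 Rg`, `SRec₁₂On cr Rg`).  At `Rg := ⊤` it is the C key (`isDatumOfRecord₁₂COn_true_iff`).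
[cite: Balaban1989LargeFieldII, Thm 1 + (0.1) pp.355–356; Balaban1988Convergent, Thms 1–2 pp.262–263 (objects of record; bookkeeping)] -/
def IsDatumOfRecord₁₂COn (Rg : (F : T4Family) → Stage12Params F N → Prop) (D : FiniteEpsData F (SU N)) : Prop :=
  ∃ (θ : Stage12Params F N) (h : θ.Provisos₁₂ F N), Rg F θ ∧ θ.Admissible F N ∧ D = datumOfRecord₁₂ F N θ h

variable (Rg : (F : T4Family) → Stage12Params F N → Prop)

/-- Unfolding (`Iff.rfl`). [cite: Balaban1989LargeFieldII, Thm 1 + (0.1) pp.355–356 (bookkeeping)] -/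
theorem isDatumOfRecord₁₂COn_iff (D : FiniteEpsData F (SU N)) :
    IsDatumOfRecord₁₂COn F N Rg D ↔ ∃ (θ : Stage12Params F N) (h : θ.Provisos₁₂ F N), Rg F θ ∧ θ.Admissible F N ∧ D = datumOfRecord₁₂ F N θ h :=
  Iff.rfl

/-- Every admissible Stage-12 parameter in the regime with provisos yields a datum of record in the regime. [cite: Balaban1989LargeFieldII, Thm 1 + (0.1) pp.355–356 (bookkeeping)] -/
theorem isDatumOfRecord₁₂COn_datumOfRecord₁₂ (θ : Stage12Params F N) (h : θ.Provisos₁₂ F N) (hRg : Rg F θ) (hθ : θ.Admissible F N) :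
    IsDatumOfRecord₁₂COn F N Rg (datumOfRecord₁₂ F N θ h) :=
  ⟨θ, h, hRg, hθ, rfl⟩

/-- **THE HONEST REDUCTION, IN THE REGIME**: some datum of record in `Rg` exists at `(F, N)` iff SOME Stage-12 parameter satisfies every displayed proviso, lies in `Rg` and
is admissible; inhabitation is NOT claimed in this module. [cite: Balaban1988Convergent, (2.7) p.255, (2.21) p.258, (3.16)–(3.22) pp.268–269; Balaban1987RG1, (1.12)–(1.15) p.262 (hypothesis dictionary; bookkeeping)] -/
theorem exists_isDatumOfRecord₁₂COn_iff_exists_params :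
    (∃ D : FiniteEpsData F (SU N), IsDatumOfRecord₁₂COn F N Rg D) ↔ ∃ θ : Stage12Params F N, θ.Provisos₁₂ F N ∧ Rg F θ ∧ θ.Admissible F N := by
  constructor
  · rintro ⟨_, θ, hP, hRg, hθ, -⟩
    exact ⟨θ, hP, hRg, hθ⟩
  · rintro ⟨θ, hP, hRg, hθ⟩
    exact ⟨_, isDatumOfRecord₁₂COn_datumOfRecord₁₂ F N Rg θ hP hRg hθ⟩

/-- **A PROPERTY OF EVERY DATUM OF RECORD IN THE REGIME ⟺ THE θ-KEYED SENTENCE GUARDED BY `Rg`** (datum level). [cite: Balaban1989LargeFieldII, Thm 1 + (0.1) pp.355–356 (bookkeeping)] -/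
theorem forall_isDatumOfRecord₁₂COn_iff (P : FiniteEpsData F (SU N) → Prop) :
    (∀ D : FiniteEpsData F (SU N), IsDatumOfRecord₁₂COn F N Rg D → P D) ↔
      ∀ (θ : Stage12Params F N) (h : θ.Provisos₁₂ F N), Rg F θ → θ.Admissible F N → P (datumOfRecord₁₂ F N θ h) := by
  constructor
  · intro hall θ h hRg hθ
    exact hall _ (isDatumOfRecord₁₂COn_datumOfRecord₁₂ F N Rg θ h hRg hθ)
  · rintro hall D ⟨θ, h, hRg, hθ, rfl⟩
    exact hall θ h hRg hθ

variable {F N Rg}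
variable {D : FiniteEpsData F (SU N)}

/-- The regime forgotten: a datum of record in `Rg` is a datum of record (C key). [cite: Balaban1989LargeFieldII, Thm 1 p.355 (bookkeeping)] -/
theorem IsDatumOfRecord₁₂COn.toC (h : IsDatumOfRecord₁₂COn F N Rg D) : IsDatumOfRecord₁₂C F N D := by
  obtain ⟨θ, hP, -, hθ, hD⟩ := h
  exact ⟨θ, hP, hθ, hD⟩

/-- Monotone in the regime. [cite: Balaban1989LargeFieldII, Thm 1 p.355 (bookkeeping)] -/
theorem IsDatumOfRecord₁₂COn.mono {Rg' : (F : T4Family) → Stage12Params F N → Prop} (hle : ∀ (F : T4Family) (θ : Stage12Params F N), Rg F θ → Rg' F θ)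
    (h : IsDatumOfRecord₁₂COn F N Rg D) : IsDatumOfRecord₁₂COn F N Rg' D := by
  obtain ⟨θ, hP, hRg, hθ, hD⟩ := h
  exact ⟨θ, hP, hle F θ hRg, hθ, hD⟩

/-- At the trivial regime the key IS the C key. [cite: Balaban1989LargeFieldII, Thm 1 p.355 (bookkeeping)] -/
theorem isDatumOfRecord₁₂COn_true_iff : IsDatumOfRecord₁₂COn F N (fun _ _ => True) D ↔ IsDatumOfRecord₁₂C F N D :=
  ⟨fun h => h.toC, fun ⟨θ, hP, hθ, hD⟩ => ⟨θ, hP, trivial, hθ, hD⟩⟩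

/-- A datum of record whose C-CANONICAL parameter lies in the regime is a datum of record in the regime (companion of the (T-RATE) home's `rRec₁₂On_of_regime_params`).
[cite: Balaban1989LargeFieldII, Thm 1 p.355 (bookkeeping)] -/
theorem IsDatumOfRecord₁₂C.isDatumOfRecord₁₂COn_of_regime_params (h : IsDatumOfRecord₁₂C F N D) (hRg : Rg F h.params) : IsDatumOfRecord₁₂COn F N Rg D :=
  ⟨h.params, h.provisos, hRg, h.admissible, h.eq_datumOfRecord₁₂⟩

/-- **THE CANONICAL STAGE-12 PARAMETER OF A DATUM OF RECORD IN THE REGIME** (choice).  HONEST: it need not equal the C-canonical parameter `h.toC.params` of the same datum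
(two choices over two existentials); the regime reaches THIS parameter (`.regime`), never `IsDatumOfRecord₁₂C.params`. [cite: Balaban1989LargeFieldII, Thm 1 + (0.1) pp.355–356 (bookkeeping)] -/
def IsDatumOfRecord₁₂COn.params (h : IsDatumOfRecord₁₂COn F N Rg D) : Stage12Params F N :=
  Classical.choose h

/-- Its provisos. [cite: Balaban1988Convergent, (2.7) p.255, (2.21) p.258, (2.35) p.261 (bookkeeping)] -/
theorem IsDatumOfRecord₁₂COn.provisos (h : IsDatumOfRecord₁₂COn F N Rg D) : h.params.Provisos₁₂ F N :=
  (Classical.choose_spec h).fst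

/-- **It lies IN THE REGIME.** [cite: Balaban1988Convergent, (3.16)–(3.22) pp.268–269 (bookkeeping)] -/
theorem IsDatumOfRecord₁₂COn.regime (h : IsDatumOfRecord₁₂COn F N Rg D) : Rg F h.params :=
  (Classical.choose_spec h).snd.1

/-- Its admissibility. [cite: Balaban1987RG1, (1.12) p.262; Balaban1988Convergent, (2.10) p.256 (bookkeeping)] -/
theorem IsDatumOfRecord₁₂COn.admissible (h : IsDatumOfRecord₁₂COn F N Rg D) : h.params.Admissible F N :=
  (Classical.choose_spec h).snd.2.1

/-- **The datum IS the datum of record of its canonical parameter in the regime.** [cite: Balaban1989LargeFieldII, Thm 1 p.355 (bookkeeping)] -/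
theorem IsDatumOfRecord₁₂COn.eq_datumOfRecord₁₂ (h : IsDatumOfRecord₁₂COn F N Rg D) : D = datumOfRecord₁₂ F N h.params h.provisos :=
  (Classical.choose_spec h).snd.2.2

/-- The canonical parameter realises a C-datum key of `D` (pointed form; its `.params` is NOT asserted to be `h.params`). [cite: Balaban1989LargeFieldII, Thm 1 p.355 (bookkeeping)] -/
theorem IsDatumOfRecord₁₂COn.isDatumOfRecord₁₂C_params (h : IsDatumOfRecord₁₂COn F N Rg D) :
    IsDatumOfRecord₁₂C F N (datumOfRecord₁₂ F N h.params h.provisos) :=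
  isDatumOfRecord₁₂C_datumOfRecord₁₂ F N h.params h.provisos h.admissible

/-- The canonical parameter's coupling window is positive. [cite: Balaban1987RG1, (0.21) p.256 (bookkeeping)] -/
theorem IsDatumOfRecord₁₂COn.gamma_pos (h : IsDatumOfRecord₁₂COn F N Rg D) : 0 < h.params.γ :=
  h.admissible.toStage9.gamma_pos

/-- … and lies inside `]0, 1[`. [cite: Balaban1988Convergent, (2.28) p.259 (bookkeeping)] -/
theorem IsDatumOfRecord₁₂COn.gamma_lt_one (h : IsDatumOfRecord₁₂COn F N Rg D) : h.params.γ < 1 :=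
  h.admissible.pos₁₂.2.2.2.2

/-- The canonical parameter in the regime depends on the datum only. [cite: Balaban1989LargeFieldII, Thm 1 + (0.1) pp.355–356 (bookkeeping)] -/
theorem IsDatumOfRecord₁₂COn.params_congr {D' : FiniteEpsData F (SU N)} (h : IsDatumOfRecord₁₂COn F N Rg D) (h' : IsDatumOfRecord₁₂COn F N Rg D') (e : D = D') :
    h.params = h'.params := by
  subst e
  rfl

/-- **WHAT A CONSUMER PROVES IN THE REGIME ⟹ WHAT THE INSTANCE CARRIES**: a property of the objects of record established at EVERY admissible Stage-12 parameter IN `Rg` with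
provisos holds at the canonical parameter in the regime of every datum of record in the regime — the regime is AVAILABLE as a hypothesis. [cite: Balaban1989LargeFieldII, Thm 1 p.355 (bookkeeping)] -/
theorem IsDatumOfRecord₁₂COn.forall_params {P : (D : FiniteEpsData F (SU N)) → (θ : Stage12Params F N) → θ.Provisos₁₂ F N → Prop}
    (hP : ∀ (θ : Stage12Params F N) (hθ : θ.Provisos₁₂ F N), Rg F θ → θ.Admissible F N → P (datumOfRecord₁₂ F N θ hθ) θ hθ) (h : IsDatumOfRecord₁₂COn F N Rg D) :
    P D h.params h.provisos := by
  have := hP h.params h.provisos h.regime h.admissible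
  rwa [← h.eq_datumOfRecord₁₂] at this

/-- The datum's β-functions are the β of record at the canonical parameter's Stage-9 part. [cite: Balaban1987RG1, (1.20)–(1.22) p.264 (bookkeeping)] -/
theorem IsDatumOfRecord₁₂COn.βfun_eq_betaOfRecord₁₀ (h : IsDatumOfRecord₁₂COn F N Rg D) : D.βfun = betaOfRecord₁₀ F N h.params.toStage9Params := by
  have := βfun_datumOfRecord₁₂ F N h.params h.provisos
  rwa [← h.eq_datumOfRecord₁₂] at this

/-- The datum's coupling flow of the run `p` IS the generated history of record of the canonical parameter's Stage-9 part. [cite: Balaban1987RG1, (0.17)–(0.20) pp.255–256 (bookkeeping)] -/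
theorem IsDatumOfRecord₁₂COn.flow_g (h : IsDatumOfRecord₁₂COn F N Rg D) (p : B12.RunParams) :
    (D.C p).flow.g = gOfRecord₁₀ F N h.params.toStage9Params p := by
  have := flow_g_datumOfRecord₁₂ F N h.params h.provisos p
  rwa [← h.eq_datumOfRecord₁₂] at this

/-- A datum of record in the regime is a datum of record, Stage 0. [cite: Balaban1987RG1, (0.3)–(0.4) p.253 (bookkeeping)] -/
theorem IsDatumOfRecord₁₂COn.isDatumOfRecord₀ (h : IsDatumOfRecord₁₂COn F N Rg D) : IsDatumOfRecord₀ F N D :=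
  h.toC.isDatumOfRecord₀

/-- The β-version proviso at the canonical parameter in the regime. [cite: Balaban1987RG1, (0.13) p.254, (1.20)–(1.22) p.264 (bookkeeping)] -/
theorem IsDatumOfRecord₁₂COn.hasContTransportAlong (h : IsDatumOfRecord₁₂COn F N Rg D) : h.params.toStage8Params.HasContTransportAlong :=
  h.provisos.hasContTransportAlong

end DatumKeyOn

/-! ## §2. «`(D, w)` is a Stage-12 record realised IN THE REGIME `Rg`»; world companions; the θ-keyed guarded junction -/

section RecordKeyOn

variable (F : T4Family) (N : ℕ) [NeZero N]

/-- **«`(D, w)` is a Stage-12 record (C-class) realised in the regime `Rg`»**: `IsRecordOfRecord₁₂C F N D w`'s body (the θ-exposed key `IsRateKey₁₂`) with the parameter IN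
`Rg` — the regime-restricted record class a guarded composer quantifies over (`Spine`, `S_R00x`, `S_N27x` at `fun F D w => IsRecordOfRecord₁₂COn F N Rg D w`).  At `Rg := ⊤` it is
`IsRecordOfRecord₁₂C` (`isRecordOfRecord₁₂COn_true_iff`). [cite: Balaban1989LargeFieldII, Thm 1 + (0.1) pp.355–356; Balaban1987RG1, (0.24)–(0.25) p.257 (objects of record; bookkeeping)] -/
def IsRecordOfRecord₁₂COn (Rg : (F : T4Family) → Stage12Params F N → Prop) (D : FiniteEpsData F (SU N)) (w : WorldP) : Prop :=
  ∃ θ : Stage12Params F N, Rg F θ ∧ IsRateKey₁₂ F N D w θ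

variable (Rg : (F : T4Family) → Stage12Params F N → Prop)

/-- Unfolding (`Iff.rfl`). [cite: Balaban1989LargeFieldII, Thm 1 + (0.1) pp.355–356 (bookkeeping)] -/
theorem isRecordOfRecord₁₂COn_iff (D : FiniteEpsData F (SU N)) (w : WorldP) :
    IsRecordOfRecord₁₂COn F N Rg D w ↔ ∃ θ : Stage12Params F N, Rg F θ ∧ IsRateKey₁₂ F N D w θ :=
  Iff.rfl

/-- **Every admissible θ in the regime with provisos is a record in the regime at some world with any window `0 < γw ≤ θ.γ`.** [cite: Balaban1989LargeFieldII, Thm 1 + (0.1) pp.355–356 (bookkeeping)] -/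
theorem exists_world_isRecordOfRecord₁₂COn (θ : Stage12Params F N) (h : θ.Provisos₁₂ F N) (hRg : Rg F θ) (hθ : θ.Admissible F N) {γw : ℝ}
    (hγw : 0 < γw ∧ γw ≤ θ.γ) : ∃ w : WorldP, IsRecordOfRecord₁₂COn F N Rg (datumOfRecord₁₂ F N θ h) w ∧ w.γ = γw := by
  obtain ⟨w, hk, hγ⟩ := exists_world_isRateKey₁₂ F N θ h hθ hγw
  exact ⟨w, ⟨θ, hRg, hk⟩, hγ⟩

/-- Some datum of record in the regime exists iff some record in the regime exists. [cite: Balaban1989LargeFieldII, Thm 1 + (0.1) pp.355–356 (bookkeeping)] -/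
theorem exists_isDatumOfRecord₁₂COn_iff_exists_record :
    (∃ D : FiniteEpsData F (SU N), IsDatumOfRecord₁₂COn F N Rg D) ↔ ∃ (D : FiniteEpsData F (SU N)) (w : WorldP), IsRecordOfRecord₁₂COn F N Rg D w := by
  constructor
  · rintro ⟨_, θ, hP, hRg, hθ, rfl⟩
    obtain ⟨w, hw, -⟩ := exists_world_isRecordOfRecord₁₂COn F N Rg θ hP hRg hθ ⟨hθ.toStage9.gamma_pos, le_rfl⟩
    exact ⟨_, w, hw⟩
  · rintro ⟨D, w, θ, hRg, hk⟩
    obtain ⟨hP, hθ, hD⟩ := hk.exists_provisos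
    exact ⟨D, θ, hP, hRg, hθ, hD⟩

/-- **A WORLD-BLIND PROPERTY AT EVERY RECORD IN THE REGIME ⟺ THE θ-KEYED SENTENCE GUARDED BY `Rg`** — the junction between a composer's conclusion over the regime-restricted
record class (e.g. `YMDAG.UVSplit.Spine` at `IsRecordOfRecord₁₂COn F N Rg`) and an item text «`∀ θ (h : θ.Provisos₁₂ F N), Rg F θ → θ.Admissible F N → P (datumOfRecord₁₂ F N θ h)`».
[cite: Balaban1989LargeFieldII, Thm 1 + (0.1) pp.355–356 (bookkeeping)] -/
theorem forall_isRecordOfRecord₁₂COn_iff (P : FiniteEpsData F (SU N) → Prop) :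
    (∀ (D : FiniteEpsData F (SU N)) (w : WorldP), IsRecordOfRecord₁₂COn F N Rg D w → P D) ↔
      ∀ (θ : Stage12Params F N) (h : θ.Provisos₁₂ F N), Rg F θ → θ.Admissible F N → P (datumOfRecord₁₂ F N θ h) := by
  constructor
  · intro hall θ h hRg hθ
    obtain ⟨w, hw, -⟩ := exists_world_isRecordOfRecord₁₂COn F N Rg θ h hRg hθ ⟨hθ.toStage9.gamma_pos, le_rfl⟩
    exact hall _ w hw
  · rintro hall D w ⟨θ, hRg, hk⟩
    obtain ⟨h, hθ, rfl⟩ := hk.exists_provisos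
    exact hall θ h hRg hθ

variable {F N Rg}
variable {D : FiniteEpsData F (SU N)} {w : WorldP}

/-- The regime forgotten: a record in the regime is a Stage-12 record. [cite: Balaban1989LargeFieldII, Thm 1 p.355 (bookkeeping)] -/
theorem IsRecordOfRecord₁₂COn.isRecordOfRecord₁₂C (h : IsRecordOfRecord₁₂COn F N Rg D w) : IsRecordOfRecord₁₂C F N D w := by
  obtain ⟨θ, -, hk⟩ := h
  exact hk.isRecordOfRecord₁₂C

/-- Its datum is a datum of record in the regime. [cite: Balaban1989LargeFieldII, Thm 1 p.355 (bookkeeping)] -/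
theorem IsRecordOfRecord₁₂COn.isDatumOfRecord₁₂COn (h : IsRecordOfRecord₁₂COn F N Rg D w) : IsDatumOfRecord₁₂COn F N Rg D := by
  obtain ⟨θ, hRg, hk⟩ := h
  obtain ⟨hP, hθ, hD⟩ := hk.exists_provisos
  exact ⟨θ, hP, hRg, hθ, hD⟩

/-- **THE TUPLE IN THE REGIME BEHIND A RECORD IN THE REGIME** — exactly the hypothesis shape of the (T-RATE) home's `s_R00x_rRec₁₂On_of_regime` («every record of `Rec` comes with
an admissible tuple with provisos in the regime realising `D`»): ONE application. [cite: Balaban1989LargeFieldII, Thm 1 + (0.1) pp.355–356 (bookkeeping)] -/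
theorem IsRecordOfRecord₁₂COn.exists_regime_tuple (h : IsRecordOfRecord₁₂COn F N Rg D w) :
    ∃ (θ : Stage12Params F N) (hP : θ.Provisos₁₂ F N), Rg F θ ∧ θ.Admissible F N ∧ D = datumOfRecord₁₂ F N θ hP :=
  h.isDatumOfRecord₁₂COn

/-- Monotone in the regime. [cite: Balaban1989LargeFieldII, Thm 1 p.355 (bookkeeping)] -/
theorem IsRecordOfRecord₁₂COn.mono {Rg' : (F : T4Family) → Stage12Params F N → Prop} (hle : ∀ (F : T4Family) (θ : Stage12Params F N), Rg F θ → Rg' F θ)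
    (h : IsRecordOfRecord₁₂COn F N Rg D w) : IsRecordOfRecord₁₂COn F N Rg' D w := by
  obtain ⟨θ, hRg, hk⟩ := h
  exact ⟨θ, hle F θ hRg, hk⟩

/-- The world's window is positive. [cite: Balaban1987RG1, Thm 1 p.259 (bookkeeping)] -/
theorem IsRecordOfRecord₁₂COn.gamma_pos (h : IsRecordOfRecord₁₂COn F N Rg D w) : 0 < w.γ := by
  obtain ⟨θ, -, hk⟩ := h
  exact hk.gamma_pos

/-- The world is bound to the datum's construction. [cite: Balaban1989LargeFieldII, Thm 1 + (0.1) pp.355–356 (bookkeeping)] -/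
theorem IsRecordOfRecord₁₂COn.construction_eq (h : IsRecordOfRecord₁₂COn F N Rg D w) : w.C = D.C := by
  obtain ⟨θ, -, hk⟩ := h
  exact hk.construction_eq

/-- A Stage-12 record keyed at a θ IN THE REGIME is a record in the regime (pointed intro). [cite: Balaban1989LargeFieldII, Thm 1 + (0.1) pp.355–356 (bookkeeping)] -/
theorem IsRateKey₁₂.isRecordOfRecord₁₂COn {θ : Stage12Params F N} (hk : IsRateKey₁₂ F N D w θ) (hRg : Rg F θ) : IsRecordOfRecord₁₂COn F N Rg D w :=
  ⟨θ, hRg, hk⟩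

/-- At the trivial regime the record key IS `IsRecordOfRecord₁₂C`. [cite: Balaban1989LargeFieldII, Thm 1 p.355 (bookkeeping)] -/
theorem isRecordOfRecord₁₂COn_true_iff : IsRecordOfRecord₁₂COn F N (fun _ _ => True) D w ↔ IsRecordOfRecord₁₂C F N D w :=
  ⟨fun h => h.isRecordOfRecord₁₂C, fun ⟨θ, hk⟩ => ⟨θ, trivial, hk⟩⟩

/-- **DATUM OF RECORD IN THE REGIME ⟺ RECORD IN THE REGIME AT SOME WORLD.** [cite: Balaban1989LargeFieldII, Thm 1 + (0.1) pp.355–356 (bookkeeping)] -/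
theorem isDatumOfRecord₁₂COn_iff_exists_world : IsDatumOfRecord₁₂COn F N Rg D ↔ ∃ w : WorldP, IsRecordOfRecord₁₂COn F N Rg D w := by
  constructor
  · rintro ⟨θ, hP, hRg, hθ, rfl⟩
    obtain ⟨w, hw, -⟩ := exists_world_isRecordOfRecord₁₂COn F N Rg θ hP hRg hθ ⟨hθ.toStage9.gamma_pos, le_rfl⟩
    exact ⟨w, hw⟩
  · rintro ⟨w, hw⟩
    exact hw.isDatumOfRecord₁₂COn

/-- **WORLD COMPANION IN THE REGIME AT ANY WINDOW BELOW THE CANONICAL ONE** (what an N17-type home-keying binder consumes once the U3 radius is pinned in `]0, h.params.γ]`).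
[cite: Balaban1989LargeFieldII, Thm 1 + (0.1) pp.355–356 (bookkeeping)] -/
theorem IsDatumOfRecord₁₂COn.exists_world (h : IsDatumOfRecord₁₂COn F N Rg D) {γw : ℝ} (hγw : 0 < γw ∧ γw ≤ h.params.γ) :
    ∃ w : WorldP, IsRecordOfRecord₁₂COn F N Rg D w ∧ w.γ = γw := by
  obtain ⟨w, hw, hγ⟩ := exists_world_isRecordOfRecord₁₂COn F N Rg h.params h.provisos h.regime h.admissible hγw
  exact ⟨w, h.eq_datumOfRecord₁₂ ▸ hw, hγ⟩

/-- … in particular at the canonical window itself. [cite: Balaban1989LargeFieldII, Thm 1 + (0.1) pp.355–356 (bookkeeping)] -/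
theorem IsDatumOfRecord₁₂COn.exists_world_gamma (h : IsDatumOfRecord₁₂COn F N Rg D) :
    ∃ w : WorldP, IsRecordOfRecord₁₂COn F N Rg D w ∧ w.γ = h.params.γ :=
  h.exists_world ⟨h.gamma_pos, le_rfl⟩

/-- The ₅C shadow at the canonical parameter in the regime (for consumers keyed at ₅C). [cite: Balaban1989LargeFieldII, Thm 1 + (0.1) pp.355–356 (bookkeeping)] -/
theorem IsDatumOfRecord₁₂COn.exists_isRecordOfRecord₅C (h : IsDatumOfRecord₁₂COn F N Rg D) :
    ∃ (D₅ : FiniteEpsData F (SU N)) (w : WorldP), IsRecordOfRecord₅C F N D₅ w ∧ D₅.C = D.C ∧ (∀ K g₀ k, D₅.dens K g₀ k = D.dens K g₀ k) ∧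
      D₅.βfun = D.βfun ∧ D₅.av = D.av :=
  h.toC.exists_isRecordOfRecord₅C

end RecordKeyOn

/-! ## §3. Canonicalised readings RELATIVE TO THE REGIME — coherence for regime homes keyed «`∃ θ hP, Rg F θ ∧ θ.Admissible F N ∧ D = datumOfRecord₁₂ F N θ hP ∧ S = cr F θ hP …`»

As `canon₁₂` (gen 2) for the C key: reading a regime-keyed record through `canon₁₂On Rg f` makes the admitted bundle a function of the DATUM, read at the canonical parameter IN
THE REGIME, so two regime homes read through `canon₁₂On Rg` admit, at the same `(F, D, g₀, os)`, bundles read at ONE parameter (`exists_keyed_canon₁₂On_iff`,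
`keyed_canon₁₂On_coherent`).  Off the class `canon₁₂On Rg f = f`. -/
section CanonOn

variable (F : T4Family) (N : ℕ) [NeZero N] (Rg : (F : T4Family) → Stage12Params F N → Prop) {α : Sort*}

/-- **CANONICALISED READING RELATIVE TO THE REGIME**: read `f` at the canonical parameter in `Rg` of the datum `datumOfRecord₁₂ F N θ hP` when that datum is of record in the
regime, else at `(θ, hP)` itself.  Kernel bookkeeping (`Classical.dec`, `dite`). [cite: Balaban1989LargeFieldII, Thm 1 + (0.1) pp.355–356 (bookkeeping)] -/
def canon₁₂On (f : (θ : Stage12Params F N) → θ.Provisos₁₂ F N → α) (θ : Stage12Params F N) (hP : θ.Provisos₁₂ F N) : α := by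
  classical
  exact if h : IsDatumOfRecord₁₂COn F N Rg (datumOfRecord₁₂ F N θ hP) then f h.params h.provisos else f θ hP

variable {F N Rg}

/-- **`canon₁₂On Rg f θ hP = f h.params h.provisos`** whenever `(θ, hP)` realises a datum of record in the regime `D` with key `h`. [cite: Balaban1989LargeFieldII, Thm 1 + (0.1) pp.355–356 (bookkeeping)] -/
theorem canon₁₂On_eq_of_eq {f : (θ : Stage12Params F N) → θ.Provisos₁₂ F N → α} {D : FiniteEpsData F (SU N)} (h : IsDatumOfRecord₁₂COn F N Rg D)
    (θ : Stage12Params F N) (hP : θ.Provisos₁₂ F N) (e : D = datumOfRecord₁₂ F N θ hP) :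
    canon₁₂On F N Rg f θ hP = f h.params h.provisos := by
  subst e
  unfold canon₁₂On
  rw [dif_pos h]

/-- At the canonical parameter in the regime `canon₁₂On Rg f` reads `f`. [cite: Balaban1989LargeFieldII, Thm 1 + (0.1) pp.355–356 (bookkeeping)] -/
theorem canon₁₂On_params {f : (θ : Stage12Params F N) → θ.Provisos₁₂ F N → α} {D : FiniteEpsData F (SU N)} (h : IsDatumOfRecord₁₂COn F N Rg D) :
    canon₁₂On F N Rg f h.params h.provisos = f h.params h.provisos :=
  canon₁₂On_eq_of_eq h h.params h.provisos h.eq_datumOfRecord₁₂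

/-- At an admissible tuple IN THE REGIME with provisos, `canon₁₂On Rg f` reads `f` at the canonical parameter in the regime of ITS datum. [cite: Balaban1989LargeFieldII, Thm 1 + (0.1) pp.355–356 (bookkeeping)] -/
theorem canon₁₂On_eq_of_regime {f : (θ : Stage12Params F N) → θ.Provisos₁₂ F N → α} (θ : Stage12Params F N) (hP : θ.Provisos₁₂ F N) (hRg : Rg F θ)
    (hθ : θ.Admissible F N) :
    canon₁₂On F N Rg f θ hP = f (isDatumOfRecord₁₂COn_datumOfRecord₁₂ F N Rg θ hP hRg hθ).params (isDatumOfRecord₁₂COn_datumOfRecord₁₂ F N Rg θ hP hRg hθ).provisos :=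
  canon₁₂On_eq_of_eq _ θ hP rfl

/-- Off the class nothing is canonicalised. [cite: Balaban1989LargeFieldII, Thm 1 + (0.1) pp.355–356 (bookkeeping)] -/
theorem canon₁₂On_eq_self_of_not {f : (θ : Stage12Params F N) → θ.Provisos₁₂ F N → α} (θ : Stage12Params F N) (hP : θ.Provisos₁₂ F N)
    (hn : ¬ IsDatumOfRecord₁₂COn F N Rg (datumOfRecord₁₂ F N θ hP)) : canon₁₂On F N Rg f θ hP = f θ hP := by
  unfold canon₁₂On
  rw [dif_neg hn]

/-- **THE KEYED-RECORD FACE, IN THE REGIME**: a regime-keyed record read through `canon₁₂On Rg f` IS the datum-keyed record «the bundle reads `f` at the canonical parameter in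
the regime of `D`», for every property `Φ` of the reading. [cite: Balaban1989LargeFieldII, Thm 1 + (0.1) pp.355–356 (bookkeeping)] -/
theorem exists_keyed_canon₁₂On_iff {f : (θ : Stage12Params F N) → θ.Provisos₁₂ F N → α} {D : FiniteEpsData F (SU N)} (Φ : α → Prop) :
    (∃ (θ : Stage12Params F N) (hP : θ.Provisos₁₂ F N), Rg F θ ∧ θ.Admissible F N ∧ D = datumOfRecord₁₂ F N θ hP ∧ Φ (canon₁₂On F N Rg f θ hP)) ↔
      ∃ h : IsDatumOfRecord₁₂COn F N Rg D, Φ (f h.params h.provisos) := by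
  constructor
  · rintro ⟨θ, hP, hRg, hθ, e, hΦ⟩
    have h : IsDatumOfRecord₁₂COn F N Rg D := ⟨θ, hP, hRg, hθ, e⟩
    refine ⟨h, ?_⟩
    rwa [canon₁₂On_eq_of_eq (f := f) h θ hP e] at hΦ
  · rintro ⟨h, hΦ⟩
    refine ⟨h.params, h.provisos, h.regime, h.admissible, h.eq_datumOfRecord₁₂, ?_⟩
    rwa [canon₁₂On_params (f := f) h]

/-- **COHERENCE IN THE REGIME**: two regime-keyed records read through `canon₁₂On Rg` admit, at the same datum, readings AT THE SAME PARAMETER.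
[cite: Balaban1989LargeFieldII, Thm 1 + (0.1) pp.355–356 (bookkeeping)] -/
theorem keyed_canon₁₂On_coherent {β : Sort*} {f : (θ : Stage12Params F N) → θ.Provisos₁₂ F N → α} {g : (θ : Stage12Params F N) → θ.Provisos₁₂ F N → β}
    {D : FiniteEpsData F (SU N)} (Φ : α → Prop) (Ψ : β → Prop)
    (hΦ : ∃ (θ : Stage12Params F N) (hP : θ.Provisos₁₂ F N), Rg F θ ∧ θ.Admissible F N ∧ D = datumOfRecord₁₂ F N θ hP ∧ Φ (canon₁₂On F N Rg f θ hP))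
    (hΨ : ∃ (θ : Stage12Params F N) (hP : θ.Provisos₁₂ F N), Rg F θ ∧ θ.Admissible F N ∧ D = datumOfRecord₁₂ F N θ hP ∧ Ψ (canon₁₂On F N Rg g θ hP)) :
    ∃ h : IsDatumOfRecord₁₂COn F N Rg D, Φ (f h.params h.provisos) ∧ Ψ (g h.params h.provisos) := by
  obtain ⟨h, h₁⟩ := (exists_keyed_canon₁₂On_iff Φ).1 hΦ
  obtain ⟨h', h₂⟩ := (exists_keyed_canon₁₂On_iff Ψ).1 hΨ
  exact ⟨h, h₁, h₂⟩

end CanonOn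

/-! ## §4. THE GUARD OF RECORD «partition of unity ∧ non-degenerate present slots» and the CN instances

The route's Stage-12 items (rev 15) bundle `θ.ZtUnity F N` (print's partition of unity for the residual 𝐓-weights, [Balaban1988Convergent] (3.16)–(3.20)) and
`θ.SlotsNondegenerate` (no present slot of record is the zero density, (3.22)) into ONE conjunction on the datum's own parameter.  Named once as a regime; the «CN key» is
§1–§3 at that regime. -/

section Guard

variable (F : T4Family) (N : ℕ) [NeZero N]

/-- **THE GUARD OF RECORD, as a regime**: `θ.ZtUnity F N ∧ θ.SlotsNondegenerate` — print's partition of unity for the residual 𝐓-weights AND non-degeneracy of the present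
slots, ONE bundled conjunction on the same `θ` (director-ym LINE №112; NOT a proviso: hypotheses a consumer takes and destructures).
[cite: Balaban1988Convergent, (3.16)–(3.20) pp.268–269, (3.22) p.269] -/
abbrev unityNondeg₁₂ : (F : T4Family) → Stage12Params F N → Prop :=
  fun F θ => θ.ZtUnity F N ∧ θ.SlotsNondegenerate

/-- Unfolding (`Iff.rfl`). [cite: Balaban1988Convergent, (3.16)–(3.22) pp.268–269 (bookkeeping)] -/
theorem unityNondeg₁₂_iff (θ : Stage12Params F N) : unityNondeg₁₂ N F θ ↔ θ.ZtUnity F N ∧ θ.SlotsNondegenerate :=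
  Iff.rfl

/-- **THE CN KEY — «`D` is a datum of record, Stage 12, realised by an admissible tuple WITH print's partition of unity AND non-degenerate present slots»**: the datum key
at the guard of record. [cite: Balaban1989LargeFieldII, Thm 1 + (0.1) pp.355–356; Balaban1988Convergent, (3.16)–(3.22) pp.268–269 (objects of record; bookkeeping)] -/
abbrev IsDatumOfRecord₁₂CN (D : FiniteEpsData F (SU N)) : Prop :=
  IsDatumOfRecord₁₂COn F N (unityNondeg₁₂ N) D

/-- **THE CN RECORD CLASS** at the guard of record. [cite: Balaban1989LargeFieldII, Thm 1 + (0.1) pp.355–356; Balaban1988Convergent, (3.16)–(3.22) pp.268–269 (objects of record; bookkeeping)] -/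
abbrev IsRecordOfRecord₁₂CN (D : FiniteEpsData F (SU N)) (w : WorldP) : Prop :=
  IsRecordOfRecord₁₂COn F N (unityNondeg₁₂ N) D w

/-- **The CN key, literally**: SOME Stage-12 parameter with provisos, `(θ.ZtUnity F N ∧ θ.SlotsNondegenerate)`, admissible, has `D` as its datum of record (`Iff.rfl`).
[cite: Balaban1989LargeFieldII, Thm 1 + (0.1) pp.355–356; Balaban1988Convergent, (3.16)–(3.22) pp.268–269 (bookkeeping)] -/
theorem isDatumOfRecord₁₂CN_iff (D : FiniteEpsData F (SU N)) :
    IsDatumOfRecord₁₂CN F N D ↔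
      ∃ (θ : Stage12Params F N) (h : θ.Provisos₁₂ F N), (θ.ZtUnity F N ∧ θ.SlotsNondegenerate) ∧ θ.Admissible F N ∧ D = datumOfRecord₁₂ F N θ h :=
  Iff.rfl

/-- **The CN record class, literally** (`Iff.rfl`). [cite: Balaban1989LargeFieldII, Thm 1 + (0.1) pp.355–356 (bookkeeping)] -/
theorem isRecordOfRecord₁₂CN_iff (D : FiniteEpsData F (SU N)) (w : WorldP) :
    IsRecordOfRecord₁₂CN F N D w ↔ ∃ θ : Stage12Params F N, (θ.ZtUnity F N ∧ θ.SlotsNondegenerate) ∧ IsRateKey₁₂ F N D w θ :=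
  Iff.rfl

/-- Intro at a guarded admissible tuple with provisos. [cite: Balaban1989LargeFieldII, Thm 1 + (0.1) pp.355–356 (bookkeeping)] -/
theorem isDatumOfRecord₁₂CN_datumOfRecord₁₂ (θ : Stage12Params F N) (h : θ.Provisos₁₂ F N) (hG : θ.ZtUnity F N ∧ θ.SlotsNondegenerate) (hθ : θ.Admissible F N) :
    IsDatumOfRecord₁₂CN F N (datumOfRecord₁₂ F N θ h) :=
  isDatumOfRecord₁₂COn_datumOfRecord₁₂ F N _ θ h hG hθ

/-- **K0′ READS THE SAME AT THE CN DATUM**: some CN datum of record exists at `(F, N)` iff SOME Stage-12 parameter satisfies every displayed proviso, print's partition of unity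
and non-degeneracy of the present slots, and is admissible — the body of the route's `Record12Inhabited` (rev 15) at `(F, N)`, verbatim; inhabitation is NOT claimed here.
[cite: Balaban1988Convergent, (2.7) p.255, (2.21) p.258, (2.28) p.259, (3.16)–(3.22) pp.268–269; Balaban1987RG1, (1.12)–(1.15) p.262 (hypothesis dictionary; bookkeeping)] -/
theorem exists_isDatumOfRecord₁₂CN_iff_exists_params :
    (∃ D : FiniteEpsData F (SU N), IsDatumOfRecord₁₂CN F N D) ↔
      ∃ θ : Stage12Params F N, θ.Provisos₁₂ F N ∧ (θ.ZtUnity F N ∧ θ.SlotsNondegenerate) ∧ θ.Admissible F N :=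
  exists_isDatumOfRecord₁₂COn_iff_exists_params F N _

/-- … and iff some CN record exists. [cite: Balaban1989LargeFieldII, Thm 1 + (0.1) pp.355–356 (bookkeeping)] -/
theorem exists_isRecordOfRecord₁₂CN_iff_exists_params :
    (∃ (D : FiniteEpsData F (SU N)) (w : WorldP), IsRecordOfRecord₁₂CN F N D w) ↔
      ∃ θ : Stage12Params F N, θ.Provisos₁₂ F N ∧ (θ.ZtUnity F N ∧ θ.SlotsNondegenerate) ∧ θ.Admissible F N :=
  (exists_isDatumOfRecord₁₂COn_iff_exists_record F N _).symm.trans (exists_isDatumOfRecord₁₂CN_iff_exists_params F N)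

/-- **THE K2′ ∕ K3′ JUNCTION**: a world-blind property at EVERY CN record ⟺ the θ-keyed sentence «`∀ θ (h : θ.Provisos₁₂ F N), (θ.ZtUnity F N ∧ θ.SlotsNondegenerate) →
θ.Admissible F N → P (datumOfRecord₁₂ F N θ h)`» — the items' binder prefix (what a `Spine` ∕ endpoint composer over the CN record class reads the text off).
[cite: Balaban1989LargeFieldII, Thm 1 + (0.1) pp.355–356 (bookkeeping)] -/
theorem forall_isRecordOfRecord₁₂CN_iff (P : FiniteEpsData F (SU N) → Prop) :
    (∀ (D : FiniteEpsData F (SU N)) (w : WorldP), IsRecordOfRecord₁₂CN F N D w → P D) ↔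
      ∀ (θ : Stage12Params F N) (h : θ.Provisos₁₂ F N), (θ.ZtUnity F N ∧ θ.SlotsNondegenerate) → θ.Admissible F N → P (datumOfRecord₁₂ F N θ h) :=
  forall_isRecordOfRecord₁₂COn_iff F N _ P

/-- … datum-level form. [cite: Balaban1989LargeFieldII, Thm 1 + (0.1) pp.355–356 (bookkeeping)] -/
theorem forall_isDatumOfRecord₁₂CN_iff (P : FiniteEpsData F (SU N) → Prop) :
    (∀ D : FiniteEpsData F (SU N), IsDatumOfRecord₁₂CN F N D → P D) ↔
      ∀ (θ : Stage12Params F N) (h : θ.Provisos₁₂ F N), (θ.ZtUnity F N ∧ θ.SlotsNondegenerate) → θ.Admissible F N → P (datumOfRecord₁₂ F N θ h) :=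
  forall_isDatumOfRecord₁₂COn_iff F N _ P

/-- Every guarded admissible θ with provisos is a CN record at some world with any window `0 < γw ≤ θ.γ`. [cite: Balaban1989LargeFieldII, Thm 1 + (0.1) pp.355–356 (bookkeeping)] -/
theorem exists_world_isRecordOfRecord₁₂CN (θ : Stage12Params F N) (h : θ.Provisos₁₂ F N) (hG : θ.ZtUnity F N ∧ θ.SlotsNondegenerate) (hθ : θ.Admissible F N)
    {γw : ℝ} (hγw : 0 < γw ∧ γw ≤ θ.γ) : ∃ w : WorldP, IsRecordOfRecord₁₂CN F N (datumOfRecord₁₂ F N θ h) w ∧ w.γ = γw :=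
  exists_world_isRecordOfRecord₁₂COn F N _ θ h hG hθ hγw

variable {F N}
variable {D : FiniteEpsData F (SU N)} {w : WorldP}

/-- **THE GUARD AT THE CANONICAL CN PARAMETER** — the one thing the C key cannot supply. [cite: Balaban1988Convergent, (3.16)–(3.22) pp.268–269 (bookkeeping)] -/
theorem IsDatumOfRecord₁₂CN.guard (h : IsDatumOfRecord₁₂CN F N D) : h.params.ZtUnity F N ∧ h.params.SlotsNondegenerate :=
  h.regime

/-- Print's partition of unity at the canonical CN parameter. [cite: Balaban1988Convergent, (3.16)–(3.20) pp.268–269 (bookkeeping)] -/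
theorem IsDatumOfRecord₁₂CN.ztUnity (h : IsDatumOfRecord₁₂CN F N D) : h.params.ZtUnity F N :=
  h.regime.1

/-- Non-degeneracy of the present slots at the canonical CN parameter. [cite: Balaban1988Convergent, (3.22) p.269 (bookkeeping)] -/
theorem IsDatumOfRecord₁₂CN.slotsNondegenerate (h : IsDatumOfRecord₁₂CN F N D) : h.params.SlotsNondegenerate :=
  h.regime.2

/-- **WHAT A CONSUMER PROVES UNDER THE GUARD ⟹ WHAT THE CN INSTANCE CARRIES** (the items' binder order: guard, then admissibility). [cite: Balaban1989LargeFieldII, Thm 1 p.355 (bookkeeping)] -/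
theorem IsDatumOfRecord₁₂CN.forall_params {P : (D : FiniteEpsData F (SU N)) → (θ : Stage12Params F N) → θ.Provisos₁₂ F N → Prop}
    (hP : ∀ (θ : Stage12Params F N) (hθ : θ.Provisos₁₂ F N), (θ.ZtUnity F N ∧ θ.SlotsNondegenerate) → θ.Admissible F N → P (datumOfRecord₁₂ F N θ hθ) θ hθ)
    (h : IsDatumOfRecord₁₂CN F N D) : P D h.params h.provisos :=
  IsDatumOfRecord₁₂COn.forall_params hP h

/-- A CN datum is a C datum (the guard forgotten; its C-canonical parameter is NOT asserted to satisfy the guard). [cite: Balaban1989LargeFieldII, Thm 1 p.355 (bookkeeping)] -/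
theorem IsDatumOfRecord₁₂CN.isDatumOfRecord₁₂C (h : IsDatumOfRecord₁₂CN F N D) : IsDatumOfRecord₁₂C F N D :=
  h.toC

/-- A CN record is a Stage-12 record. [cite: Balaban1989LargeFieldII, Thm 1 p.355 (bookkeeping)] -/
theorem IsRecordOfRecord₁₂CN.isRecordOfRecord₁₂C' (h : IsRecordOfRecord₁₂CN F N D w) : IsRecordOfRecord₁₂C F N D w :=
  h.isRecordOfRecord₁₂C

/-- The guarded tuple behind a CN record (feeds `s_R00x_rRec₁₂On_of_regime 𝔯 (unityNondeg₁₂ N)` in one application). [cite: Balaban1989LargeFieldII, Thm 1 + (0.1) pp.355–356 (bookkeeping)] -/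
theorem IsRecordOfRecord₁₂CN.exists_guarded_tuple (h : IsRecordOfRecord₁₂CN F N D w) :
    ∃ (θ : Stage12Params F N) (hP : θ.Provisos₁₂ F N), (θ.ZtUnity F N ∧ θ.SlotsNondegenerate) ∧ θ.Admissible F N ∧ D = datumOfRecord₁₂ F N θ hP :=
  h.exists_regime_tuple

/-- A datum of record whose C-canonical parameter satisfies the guard is a CN datum. [cite: Balaban1989LargeFieldII, Thm 1 p.355 (bookkeeping)] -/
theorem IsDatumOfRecord₁₂C.isDatumOfRecord₁₂CN_of_guard (h : IsDatumOfRecord₁₂C F N D) (hG : h.params.ZtUnity F N ∧ h.params.SlotsNondegenerate) :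
    IsDatumOfRecord₁₂CN F N D :=
  h.isDatumOfRecord₁₂COn_of_regime_params hG

end Guard

end Literature.MathematicalPhysics.QuantumFieldTheory.Balaban1983to89.Node00

end
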